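import Summits.Ventures.WeilGRH.CensusTwoPrimeRungs
import Summits.Ventures.WeilGRH.SmallConductorWindows
import Summits.Ventures.WeilGRH.ReflectionRungsSmallModuli
import Summits.Ventures.WeilGRH.BaseRungOddTransfer
import HarnessLib

/-!
# GRH arm (rh-explicit, venture WeilGRH): named census cells of small conductor (`q ≤ 9`) — the rungs of record
  as theorems about the census characters

Cell `rh-explicit`, WEIL TRACK — GRH ARM (census / typing seat weil-grh-1).  Sequel of `CensusTwoPrimeRungs{,2,3}.lean`.
weil-grh-2's small-modulus theorems (`SmallConductorWindows.lean`, `ReflectionRungsSmallModuli.lean`,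
`BaseRungOddTransfer.lean`) either hold for every character of the modulus or carry `χ(2) ≠ 1`; here they are
instantiated / discharged for the NAMED rows of the census (`χ(2) = ζ_ord^{E[2]} ≠ 1` when `0 ≠ E[2] < ord`,
primitive-root argument):

| cells | rung | via |
|---|---|---|
| 3.2 | 1/4 | `weilPositivityOnChar_quarter_of_mod_three` |
| 4.3 | 1/3 | `weilPositivityOnChar_third_of_mod_four` |
| 5.2, 5.3, 5.4 | 2/5 | `…_two_fifths_mod_five` (`χ(2) = i, −i, −1 ≠ 1`) |
| 7.2, 7.3, 7.4, 7.5 | (log 3)/2 | `…_log_three_half_mod_seven` (`χ(2) ≠ 1`; 7.6 has `χ(2) = 1` — hold-out) |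
| 7.6 | (log 2)/2 | `weilPositivityOnChar_log_two_half` (`q ≥ 5`) |
| 8.3, 8.5 | (log 3)/2 | `…_log_three_half_of_even_ge_eight` |
| 9.2, 9.4, 9.5, 9.7 | (log 3)/2 | `…_log_three_half_mod_nine` (`χ(2) ≠ 1`) |

(For `q ≥ 10` every character has `(log 3)/2` by `weilPositivityOnChar_log_three_half_of_ge_ten`, no discharge needed.)
No new definitions; no named facts; RH/GRH-free.
-/

noncomputable section

open Complex
open scoped Real ComplexConjugate

namespace Summit.Ventures.WeilGRH

open Literature.NumberTheory.LFunctions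

/-- `(2 : ZMod q)` is the cast of the natural number `2`. -/
private theorem two_eq_natCast₄ (q : ℕ) : (2 : ZMod q) = ((2 : ℕ) : ZMod q) := by norm_cast

/-- `χ(2) ≠ 1` for a census row with `E[2] ≠ 0`, `E[2] < ord` (`ζ_ord` is a primitive root of unity). -/
theorem censusRow_toChar_two_ne_one (q n : ℕ) (h : (censusRow q n).check = true)
    (hsh : (censusRow q n).checkShape = true) (hcop : Nat.Coprime 2 (censusRow q n).q)
    (h0 : (censusRow q n).e 2 ≠ 0) (hlt : (censusRow q n).e 2 < (censusRow q n).ord) :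
    (censusRow q n).toChar h (2 : ZMod (censusRow q n).q) ≠ 1 := by
  rw [two_eq_natCast₄, ConreyRow.toChar_apply_natCast, if_pos hcop]
  exact (ConreyRow.isPrimitiveRoot_zeta hsh).pow_ne_one_of_pos_of_lt h0 hlt

/-! ## q = 3, 4 -/

/-- **Cell 3.2 at `1/4`** (`(−3/·)`). -/
theorem weilPositivityOnChar_quarter_census_3_2 :
    WeilPositivityOnChar ((censusRow 3 2).toChar (census20_check _ (by decide))) (1 / 4) :=
  weilPositivityOnChar_quarter_of_mod_three _

/-- **Cell 4.3 at `1/3`** (`(−4/·)`). -/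
theorem weilPositivityOnChar_third_census_4_3 :
    WeilPositivityOnChar ((censusRow 4 3).toChar (census20_check _ (by decide))) (1 / 3) :=
  weilPositivityOnChar_third_of_mod_four _

/-! ## q = 5 at `2/5` -/

/-- **Cell 5.2 at `2/5`** (`χ(2) = i`). -/
theorem weilPositivityOnChar_two_fifths_census_5_2 :
    WeilPositivityOnChar ((censusRow 5 2).toChar (census20_check _ (by decide))) (2 / 5) :=
  weilPositivityOnChar_two_fifths_mod_five _
    (censusRow_toChar_two_ne_one 5 2 _ (by decide) (by decide) (by decide) (by decide))

/-- **Cell 5.3 at `2/5`** (`χ(2) = −i`). -/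
theorem weilPositivityOnChar_two_fifths_census_5_3 :
    WeilPositivityOnChar ((censusRow 5 3).toChar (census20_check _ (by decide))) (2 / 5) :=
  weilPositivityOnChar_two_fifths_mod_five _
    (censusRow_toChar_two_ne_one 5 3 _ (by decide) (by decide) (by decide) (by decide))

/-- **Cell 5.4 at `2/5`** (`(5/·)`, `χ(2) = −1`). -/
theorem weilPositivityOnChar_two_fifths_census_5_4 :
    WeilPositivityOnChar ((censusRow 5 4).toChar (census20_check _ (by decide))) (2 / 5) :=
  weilPositivityOnChar_two_fifths_mod_five _
    (censusRow_toChar_two_ne_one 5 4 _ (by decide) (by decide) (by decide) (by decide))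

/-! ## q = 7 -/

/-- **Cell 7.2 at `(log 3)/2`** (`χ(2) = ζ₃²`). -/
theorem weilPositivityOnChar_log_three_half_census_7_2 :
    WeilPositivityOnChar ((censusRow 7 2).toChar (census20_check _ (by decide))) (Real.log 3 / 2) :=
  weilPositivityOnChar_log_three_half_mod_seven _
    (censusRow_toChar_two_ne_one 7 2 _ (by decide) (by decide) (by decide) (by decide))

/-- **Cell 7.3 at `(log 3)/2`** (`χ(2) = ζ₆²`). -/
theorem weilPositivityOnChar_log_three_half_census_7_3 :
    WeilPositivityOnChar ((censusRow 7 3).toChar (census20_check _ (by decide))) (Real.log 3 / 2) :=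
  weilPositivityOnChar_log_three_half_mod_seven _
    (censusRow_toChar_two_ne_one 7 3 _ (by decide) (by decide) (by decide) (by decide))

/-- **Cell 7.4 at `(log 3)/2`** (`χ(2) = ζ₃`). -/
theorem weilPositivityOnChar_log_three_half_census_7_4 :
    WeilPositivityOnChar ((censusRow 7 4).toChar (census20_check _ (by decide))) (Real.log 3 / 2) :=
  weilPositivityOnChar_log_three_half_mod_seven _
    (censusRow_toChar_two_ne_one 7 4 _ (by decide) (by decide) (by decide) (by decide))

/-- **Cell 7.5 at `(log 3)/2`** (`χ(2) = ζ₆⁴`). -/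
theorem weilPositivityOnChar_log_three_half_census_7_5 :
    WeilPositivityOnChar ((censusRow 7 5).toChar (census20_check _ (by decide))) (Real.log 3 / 2) :=
  weilPositivityOnChar_log_three_half_mod_seven _
    (censusRow_toChar_two_ne_one 7 5 _ (by decide) (by decide) (by decide) (by decide))

/-- **Cell 7.6 at `(log 2)/2`** (`(−7/·)`, `χ(2) = 1`: the reflection route does not reach `(log 3)/2`; the base rung holds). -/
theorem weilPositivityOnChar_log_two_half_census_7_6 :
    WeilPositivityOnChar ((censusRow 7 6).toChar (census20_check _ (by decide))) (Real.log 2 / 2) :=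
  weilPositivityOnChar_log_two_half (by decide) _

/-! ## q = 8 -/

/-- **Cell 8.3 at `(log 3)/2`** (even modulus). -/
theorem weilPositivityOnChar_log_three_half_census_8_3 :
    WeilPositivityOnChar ((censusRow 8 3).toChar (census20_check _ (by decide))) (Real.log 3 / 2) :=
  weilPositivityOnChar_log_three_half_of_even_ge_eight (by decide) (by decide) _

/-- **Cell 8.5 at `(log 3)/2`** (even modulus). -/
theorem weilPositivityOnChar_log_three_half_census_8_5 :
    WeilPositivityOnChar ((censusRow 8 5).toChar (census20_check _ (by decide))) (Real.log 3 / 2) :=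
  weilPositivityOnChar_log_three_half_of_even_ge_eight (by decide) (by decide) _

/-! ## q = 9 -/

/-- **Cell 9.2 at `(log 3)/2`** (`χ(2) = ζ₆`). -/
theorem weilPositivityOnChar_log_three_half_census_9_2 :
    WeilPositivityOnChar ((censusRow 9 2).toChar (census20_check _ (by decide))) (Real.log 3 / 2) :=
  weilPositivityOnChar_log_three_half_mod_nine _
    (censusRow_toChar_two_ne_one 9 2 _ (by decide) (by decide) (by decide) (by decide))

/-- **Cell 9.4 at `(log 3)/2`** (`χ(2) = ζ₃`). -/
theorem weilPositivityOnChar_log_three_half_census_9_4 :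
    WeilPositivityOnChar ((censusRow 9 4).toChar (census20_check _ (by decide))) (Real.log 3 / 2) :=
  weilPositivityOnChar_log_three_half_mod_nine _
    (censusRow_toChar_two_ne_one 9 4 _ (by decide) (by decide) (by decide) (by decide))

/-- **Cell 9.5 at `(log 3)/2`** (`χ(2) = ζ₆⁵`). -/
theorem weilPositivityOnChar_log_three_half_census_9_5 :
    WeilPositivityOnChar ((censusRow 9 5).toChar (census20_check _ (by decide))) (Real.log 3 / 2) :=
  weilPositivityOnChar_log_three_half_mod_nine _
    (censusRow_toChar_two_ne_one 9 5 _ (by decide) (by decide) (by decide) (by decide))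

/-- **Cell 9.7 at `(log 3)/2`** (`χ(2) = ζ₃²`). -/
theorem weilPositivityOnChar_log_three_half_census_9_7 :
    WeilPositivityOnChar ((censusRow 9 7).toChar (census20_check _ (by decide))) (Real.log 3 / 2) :=
  weilPositivityOnChar_log_three_half_mod_nine _
    (censusRow_toChar_two_ne_one 9 7 _ (by decide) (by decide) (by decide) (by decide))

end Summit.Ventures.WeilGRH

end
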